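import Summits.ResolutionOfSingularities.ResolutionOfSingularities.Theorems.FrobeniusLadderFInjectiveMacaulayficationSequentialSurgeryGlue
import HarnessLib

/-!
# G-β-rel — SEQUENTIAL SURGERY GLUE RELATIVE TO A CLASS OF BAD POINTS (crux `FInjectiveMacaulayfication`, programme T-P)

Support file for crux stmt-ResolutionOfSingularities-15315 (`FrobeniusLadder.FInjectiveMacaulayfication`), chain w45a, seat
res-L1-w45a-stub-7 (= res-D-pv-019). [OURS · L1 W4.5a] — NOT a statement of the manuscript under review; AI-written, weaker than
expert review. Ruling of record: res-L1-w45a-plan-1 R10.2 (2026-08-27T06:17:21Z), programme «T-𝒫 = ENGINE-CLASS DOOR THEOREM»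
(CRUX-PLAN v10 §2); statement = `L/w45a/ClassGlueSig.lean` v1 sha16 2e4e4aacf3a7e925 §1 `stub_sequentialSurgeryGlueOfClass` VERBATIM
(name without `stub_`): the sequential glue `SequentialSurgeryGlue.sequentialSurgeryGlue` (G-β, p503539) with its universal closed-centre
hypothesis RELATIVISED to a class `P` of pointed pairs — so that an engine class (chart-engine points: CN, graded, filtered, CI …)
whose members carry a certified centre yields an UNCONDITIONAL door-level theorem for pairs all of whose bad points lie in the class.

STATEMENT (`sequentialSurgeryGlueOfClass`). Fix `k` of characteristic `p` and a predicate `P X f b` on pointed pairs. Assume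
(ii) every admissible pair (separated, locally of finite type, quasi-compact, integral, Cohen–Macaulay stalks, finite bad set) admits
at every bad CLOSED point `b` WITH `P X f b` a non-zero ideal sheaf `J ∋ b` all of whose blowing ups satisfy the full clause over
`supp J`; (iii) TRANSPORT: for a blowing up `π : X' ⟶ X` along `J` and a point `x'` NOT over `supp J`, `P X f (π x')` implies
`P X' (π ≫ f) x'`. Then every admissible pair ALL of whose bad points satisfy `P` has a proper birational model with the full
clause at every stalk.

PROOF = G-β verbatim with the state invariant «every bad point satisfies `P`»: `surgeryStepOfClass` is `SequentialSurgeryGlue.surgeryStep`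
re-run keeping the blow-up data — the bad points of `X'` lie OFF `supp J` (points over `supp J` are good) and OVER bad points of `X`
(`IsoLocusTransport.fClause_iff_of_isIso_morphismRestrict` on `centreCompl J`, `IsBlowup.isIso_compl`), so (iii) carries `P` to
them; the measure `Set.ncard` of the bad set drops as before (`BadMaximalPoints.eq_of_base_eq_of_isIso_morphismRestrict`,
`BadPointsClosed.stub_badPointsClosed`, `b ∈ supp J`); `MeasureDescent.exists_model_of_wellFounded_step` concludes.

* `surgeryStepOfClass` — one step, with the invariant;  * `sequentialSurgeryGlueOfClass` — the glue.

No definitions, no named facts, no `sorry`. [folklore]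
-/

-- single-problem summit: the doubled namespace component is forced
set_option linter.dupNamespace false

noncomputable section

namespace Summit.ResolutionOfSingularities.ResolutionOfSingularities.Theorems.FInjectiveMacaulayfication.SequentialSurgeryGlueOfClass

open AlgebraicGeometry CategoryTheory Literature.AlgebraicGeometry.Resolution TopologicalSpace
open Summit.ResolutionOfSingularities.ResolutionOfSingularities.Theorems.FInjectiveMacaulayfication

/-- **THE SURGERY STEP, RELATIVE TO A CLASS.** As `SequentialSurgeryGlue.surgeryStep`, for a pair all of whose bad points satisfy
`P`, using the closed centre of hypothesis (ii) at a bad closed point of class `P`; the new pair again has all its bad points in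
the class by the transport (iii) (they lie off the centre, over bad points of the old pair). [folklore] -/
theorem surgeryStepOfClass (p : ℕ) (hp : p.Prime) (k : Type) [Field k] [CharP k p]
    (P : ∀ (X : Scheme.{0}), (X ⟶ Spec (.of k)) → X → Prop)
    (htr : (∀ (X₁ : Scheme.{0}) (f₁ : X₁ ⟶ Spec (.of k)),
      IsSeparated f₁ → LocallyOfFiniteType f₁ → QuasiCompact f₁ → IsIntegral X₁ →
      (∀ x : X₁, ∀ d : ℕ, ringKrullDim (X₁.presheaf.stalk x) = d → ∀ s : Fin d → X₁.presheaf.stalk x, (Ideal.span (Set.range s)).radical.IsMaximal → RingTheory.Sequence.IsWeaklyRegular (X₁.presheaf.stalk x) (List.ofFn s)) →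
      Set.Finite {x : X₁ | ¬ ∀ d : ℕ, ringKrullDim (X₁.presheaf.stalk x) = d → ∀ s : Fin d → X₁.presheaf.stalk x, (Ideal.span (Set.range s)).radical.IsMaximal → ∀ y : X₁.presheaf.stalk x, (∃ e : ℕ, y ^ p ^ e ∈ Ideal.span ((fun z : X₁.presheaf.stalk x => z ^ p ^ e) '' (Ideal.span (Set.range s) : Set (X₁.presheaf.stalk x)))) → y ∈ Ideal.span (Set.range s)} →
      ∀ (J : X₁.IdealSheafData), J ≠ ⊥ → ∀ (X' : Scheme.{0}) (π : X' ⟶ X₁), Literature.AlgebraicGeometry.Resolution.IsBlowup π J →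
        ∀ x' : X', π.base x' ∉ (J.support : Set X₁) → P X₁ f₁ (π.base x') → P X' (π ≫ f₁) x'))
    (h4 : (∀ (X₁ : Scheme.{0}) (f₁ : X₁ ⟶ Spec (.of k)),
      IsSeparated f₁ → LocallyOfFiniteType f₁ → QuasiCompact f₁ → IsIntegral X₁ →
      (∀ x : X₁, ∀ d : ℕ, ringKrullDim (X₁.presheaf.stalk x) = d → ∀ s : Fin d → X₁.presheaf.stalk x, (Ideal.span (Set.range s)).radical.IsMaximal → RingTheory.Sequence.IsWeaklyRegular (X₁.presheaf.stalk x) (List.ofFn s)) →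
      Set.Finite {x : X₁ | ¬ ∀ d : ℕ, ringKrullDim (X₁.presheaf.stalk x) = d → ∀ s : Fin d → X₁.presheaf.stalk x, (Ideal.span (Set.range s)).radical.IsMaximal → ∀ y : X₁.presheaf.stalk x, (∃ e : ℕ, y ^ p ^ e ∈ Ideal.span ((fun z : X₁.presheaf.stalk x => z ^ p ^ e) '' (Ideal.span (Set.range s) : Set (X₁.presheaf.stalk x)))) → y ∈ Ideal.span (Set.range s)} →
      ∀ b : X₁, IsClosed ({b} : Set X₁) → (¬ ∀ d : ℕ, ringKrullDim (X₁.presheaf.stalk b) = d → ∀ s : Fin d → X₁.presheaf.stalk b, (Ideal.span (Set.range s)).radical.IsMaximal → ∀ y : X₁.presheaf.stalk b, (∃ e : ℕ, y ^ p ^ e ∈ Ideal.span ((fun z : X₁.presheaf.stalk b => z ^ p ^ e) '' (Ideal.span (Set.range s) : Set (X₁.presheaf.stalk b)))) → y ∈ Ideal.span (Set.range s)) →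
      P X₁ f₁ b →
      ∃ J : X₁.IdealSheafData, J ≠ ⊥ ∧ b ∈ (J.support : Set X₁) ∧
        ∀ (X' : Scheme.{0}) (π : X' ⟶ X₁), Literature.AlgebraicGeometry.Resolution.IsBlowup π J →
          ∀ x' : X', π.base x' ∈ (J.support : Set X₁) → IsDomain (X'.presheaf.stalk x') ∧ ∀ d : ℕ, ringKrullDim (X'.presheaf.stalk x') = d → ∀ s : Fin d → X'.presheaf.stalk x', (Ideal.span (Set.range s)).radical.IsMaximal → RingTheory.Sequence.IsWeaklyRegular (X'.presheaf.stalk x') (List.ofFn s) ∧ ∀ y : X'.presheaf.stalk x', (∃ e : ℕ, y ^ p ^ e ∈ Ideal.span ((fun z : X'.presheaf.stalk x' => z ^ p ^ e) '' (Ideal.span (Set.range s) : Set (X'.presheaf.stalk x')))) → y ∈ Ideal.span (Set.range s)))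
    (X : Scheme.{0}) (f : X ⟶ Spec (.of k)) (hsep : IsSeparated f) (hft : LocallyOfFiniteType f) (hqc : QuasiCompact f)
    (hint : IsIntegral X) (hCM : ∀ x : X, ∀ d : ℕ, ringKrullDim (X.presheaf.stalk x) = d → ∀ s : Fin d → X.presheaf.stalk x, (Ideal.span (Set.range s)).radical.IsMaximal → RingTheory.Sequence.IsWeaklyRegular (X.presheaf.stalk x) (List.ofFn s))
    (hfin : Set.Finite {x : X | ¬ ∀ d : ℕ, ringKrullDim (X.presheaf.stalk x) = d → ∀ s : Fin d → X.presheaf.stalk x, (Ideal.span (Set.range s)).radical.IsMaximal → ∀ y : X.presheaf.stalk x, (∃ e : ℕ, y ^ p ^ e ∈ Ideal.span ((fun z : X.presheaf.stalk x => z ^ p ^ e) '' (Ideal.span (Set.range s) : Set (X.presheaf.stalk x)))) → y ∈ Ideal.span (Set.range s)})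
    (hP : ∀ x : X, ¬ (∀ d : ℕ, ringKrullDim (X.presheaf.stalk x) = d → ∀ s : Fin d → X.presheaf.stalk x, (Ideal.span (Set.range s)).radical.IsMaximal → ∀ y : X.presheaf.stalk x, (∃ e : ℕ, y ^ p ^ e ∈ Ideal.span ((fun z : X.presheaf.stalk x => z ^ p ^ e) '' (Ideal.span (Set.range s) : Set (X.presheaf.stalk x)))) → y ∈ Ideal.span (Set.range s)) → P X f x)
    (hbad : ∃ x : X, ¬ (∀ d : ℕ, ringKrullDim (X.presheaf.stalk x) = d → ∀ s : Fin d → X.presheaf.stalk x, (Ideal.span (Set.range s)).radical.IsMaximal → ∀ y : X.presheaf.stalk x, (∃ e : ℕ, y ^ p ^ e ∈ Ideal.span ((fun z : X.presheaf.stalk x => z ^ p ^ e) '' (Ideal.span (Set.range s) : Set (X.presheaf.stalk x)))) → y ∈ Ideal.span (Set.range s))) :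
    ∃ (X' : Scheme.{0}) (π : X' ⟶ X), IsProper π ∧ IsBirational π ∧
      IsSeparated (π ≫ f) ∧ LocallyOfFiniteType (π ≫ f) ∧ QuasiCompact (π ≫ f) ∧ IsIntegral X' ∧
      (∀ x' : X', ∀ d : ℕ, ringKrullDim (X'.presheaf.stalk x') = d → ∀ s : Fin d → X'.presheaf.stalk x', (Ideal.span (Set.range s)).radical.IsMaximal → RingTheory.Sequence.IsWeaklyRegular (X'.presheaf.stalk x') (List.ofFn s)) ∧ Set.Finite {x' : X' | ¬ ∀ d : ℕ, ringKrullDim (X'.presheaf.stalk x') = d → ∀ s : Fin d → X'.presheaf.stalk x', (Ideal.span (Set.range s)).radical.IsMaximal → ∀ y : X'.presheaf.stalk x', (∃ e : ℕ, y ^ p ^ e ∈ Ideal.span ((fun z : X'.presheaf.stalk x' => z ^ p ^ e) '' (Ideal.span (Set.range s) : Set (X'.presheaf.stalk x')))) → y ∈ Ideal.span (Set.range s)} ∧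
      (∀ x' : X', ¬ (∀ d : ℕ, ringKrullDim (X'.presheaf.stalk x') = d → ∀ s : Fin d → X'.presheaf.stalk x', (Ideal.span (Set.range s)).radical.IsMaximal → ∀ y : X'.presheaf.stalk x', (∃ e : ℕ, y ^ p ^ e ∈ Ideal.span ((fun z : X'.presheaf.stalk x' => z ^ p ^ e) '' (Ideal.span (Set.range s) : Set (X'.presheaf.stalk x')))) → y ∈ Ideal.span (Set.range s)) → P X' (π ≫ f) x') ∧ Set.ncard {x' : X' | ¬ ∀ d : ℕ, ringKrullDim (X'.presheaf.stalk x') = d → ∀ s : Fin d → X'.presheaf.stalk x', (Ideal.span (Set.range s)).radical.IsMaximal → ∀ y : X'.presheaf.stalk x', (∃ e : ℕ, y ^ p ^ e ∈ Ideal.span ((fun z : X'.presheaf.stalk x' => z ^ p ^ e) '' (Ideal.span (Set.range s) : Set (X'.presheaf.stalk x')))) → y ∈ Ideal.span (Set.range s)} < Set.ncard {x : X | ¬ ∀ d : ℕ, ringKrullDim (X.presheaf.stalk x) = d → ∀ s : Fin d → X.presheaf.stalk x, (Ideal.span (Set.range s)).radical.IsMaximal → ∀ y : X.presheaf.stalk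 x, (∃ e : ℕ, y ^ p ^ e ∈ Ideal.span ((fun z : X.presheaf.stalk x => z ^ p ^ e) '' (Ideal.span (Set.range s) : Set (X.presheaf.stalk x)))) → y ∈ Ideal.span (Set.range s)} := by
  classical
  haveI : Fact p.Prime := ⟨hp⟩
  haveI := hsep
  haveI := hft
  haveI := hqc
  haveI : IsLocallyNoetherian X := LocallyOfFiniteType.isLocallyNoetherian f
  -- a bad point, necessarily closed, of class `P`
  obtain ⟨b, hb⟩ := hbad
  have hbcl : IsClosed ({b} : Set X) := BadPointsClosed.stub_badPointsClosed p hp k X f hft hqc hCM hfin b hb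
  -- the closed centre through `b` and a blowing up along it
  obtain ⟨J, hJ0, hbJ, hgood⟩ := h4 X f hsep hft hqc hint hCM hfin b hbcl hb (hP b hb)
  obtain ⟨X', π, hπ⟩ := exists_isBlowup X J
  haveI hprop : IsProper π := hπ.isProper
  haveI : IsIntegral X' := hπ.isIntegral hJ0
  haveI : IsIso (π ∣_ centreCompl J) := hπ.isIso_compl
  have hmemU : ∀ x' : X', π.base x' ∉ (J.support : Set X) → π.base x' ∈ centreCompl J := fun x' h => h
  -- Cohen–Macaulayness of every stalk of `X'`
  have hCM' : ∀ x' : X', ∀ d : ℕ, ringKrullDim (X'.presheaf.stalk x') = d → ∀ s : Fin d → X'.presheaf.stalk x', (Ideal.span (Set.range s)).radical.IsMaximal → RingTheory.Sequence.IsWeaklyRegular (X'.presheaf.stalk x') (List.ofFn s) := by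
    intro x'
    by_cases hx' : π.base x' ∈ (J.support : Set X)
    · exact fun d hd s hs => ((hgood X' π hπ x' hx').2 d hd s hs).1
    · exact (IsoLocusTransport.cmClause_iff_of_isIso_morphismRestrict π (centreCompl J) x' (hmemU x' hx')).mp (hCM (π.base x'))
  -- bad points of `X'` lie off the centre, over bad points of `X` other than `b`
  have hoff : ∀ x' ∈ {x' : X' | ¬ ∀ d : ℕ, ringKrullDim (X'.presheaf.stalk x') = d → ∀ s : Fin d → X'.presheaf.stalk x', (Ideal.span (Set.range s)).radical.IsMaximal → ∀ y : X'.presheaf.stalk x', (∃ e : ℕ, y ^ p ^ e ∈ Ideal.span ((fun z : X'.presheaf.stalk x' => z ^ p ^ e) '' (Ideal.span (Set.range s) : Set (X'.presheaf.stalk x')))) → y ∈ Ideal.span (Set.range s)}, π.base x' ∉ (J.support : Set X) := by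
    intro x' hx' hmem
    rw [Set.mem_setOf_eq] at hx'
    exact hx' (fun d hd s hs => ((hgood X' π hπ x' hmem).2 d hd s hs).2)
  have hmaps : ∀ x' ∈ {x' : X' | ¬ ∀ d : ℕ, ringKrullDim (X'.presheaf.stalk x') = d → ∀ s : Fin d → X'.presheaf.stalk x', (Ideal.span (Set.range s)).radical.IsMaximal → ∀ y : X'.presheaf.stalk x', (∃ e : ℕ, y ^ p ^ e ∈ Ideal.span ((fun z : X'.presheaf.stalk x' => z ^ p ^ e) '' (Ideal.span (Set.range s) : Set (X'.presheaf.stalk x')))) → y ∈ Ideal.span (Set.range s)}, π.base x' ∈ {x : X | ¬ ∀ d : ℕ, ringKrullDim (X.presheaf.stalk x) = d → ∀ s : Fin d → X.presheaf.stalk x, (Ideal.span (Set.range s)).radical.IsMaximal → ∀ y : X.presheaf.stalk x, (∃ e : ℕ, y ^ p ^ e ∈ Ideal.span ((fun z : X.presheaf.stalk x => z ^ p ^ e) '' (Ideal.span (Set.range s) : Set (X.presheaf.stalk x)))) → y ∈ Ideal.span (Set.range s)} \ {b} := by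
    intro x' hx'
    have hoff' := hoff x' hx'
    rw [Set.mem_setOf_eq] at hx'
    refine ⟨?_, fun hxb => hoff' (by rw [Set.mem_singleton_iff.mp hxb]; exact hbJ)⟩
    rw [Set.mem_setOf_eq]
    exact fun hF => hx' ((IsoLocusTransport.fClause_iff_of_isIso_morphismRestrict p π (centreCompl J) x' (hmemU x' hoff')).mp hF)
  have hinj : Set.InjOn π.base {x' : X' | ¬ ∀ d : ℕ, ringKrullDim (X'.presheaf.stalk x') = d → ∀ s : Fin d → X'.presheaf.stalk x', (Ideal.span (Set.range s)).radical.IsMaximal → ∀ y : X'.presheaf.stalk x', (∃ e : ℕ, y ^ p ^ e ∈ Ideal.span ((fun z : X'.presheaf.stalk x' => z ^ p ^ e) '' (Ideal.span (Set.range s) : Set (X'.presheaf.stalk x')))) → y ∈ Ideal.span (Set.range s)} := by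
    intro x₁ hx₁ x₂ hx₂ h
    exact BadMaximalPoints.eq_of_base_eq_of_isIso_morphismRestrict π (centreCompl J) x₁ x₂ (hmemU x₁ (hoff x₁ hx₁))
      (hmemU x₂ (hoff x₂ hx₂)) h
  have hfin_diff : Set.Finite ({x : X | ¬ ∀ d : ℕ, ringKrullDim (X.presheaf.stalk x) = d → ∀ s : Fin d → X.presheaf.stalk x, (Ideal.span (Set.range s)).radical.IsMaximal → ∀ y : X.presheaf.stalk x, (∃ e : ℕ, y ^ p ^ e ∈ Ideal.span ((fun z : X.presheaf.stalk x => z ^ p ^ e) '' (Ideal.span (Set.range s) : Set (X.presheaf.stalk x)))) → y ∈ Ideal.span (Set.range s)} \ {b}) := hfin.subset Set.sdiff_subset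
  have hfin' : Set.Finite {x' : X' | ¬ ∀ d : ℕ, ringKrullDim (X'.presheaf.stalk x') = d → ∀ s : Fin d → X'.presheaf.stalk x', (Ideal.span (Set.range s)).radical.IsMaximal → ∀ y : X'.presheaf.stalk x', (∃ e : ℕ, y ^ p ^ e ∈ Ideal.span ((fun z : X'.presheaf.stalk x' => z ^ p ^ e) '' (Ideal.span (Set.range s) : Set (X'.presheaf.stalk x')))) → y ∈ Ideal.span (Set.range s)} :=
    Set.Finite.of_finite_image (hfin_diff.subset (by rintro _ ⟨x', hx', rfl⟩; exact hmaps x' hx')) hinj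
  have hlt : Set.ncard {x' : X' | ¬ ∀ d : ℕ, ringKrullDim (X'.presheaf.stalk x') = d → ∀ s : Fin d → X'.presheaf.stalk x', (Ideal.span (Set.range s)).radical.IsMaximal → ∀ y : X'.presheaf.stalk x', (∃ e : ℕ, y ^ p ^ e ∈ Ideal.span ((fun z : X'.presheaf.stalk x' => z ^ p ^ e) '' (Ideal.span (Set.range s) : Set (X'.presheaf.stalk x')))) → y ∈ Ideal.span (Set.range s)} < Set.ncard {x : X | ¬ ∀ d : ℕ, ringKrullDim (X.presheaf.stalk x) = d → ∀ s : Fin d → X.presheaf.stalk x, (Ideal.span (Set.range s)).radical.IsMaximal → ∀ y : X.presheaf.stalk x, (∃ e : ℕ, y ^ p ^ e ∈ Ideal.span ((fun z : X.presheaf.stalk x => z ^ p ^ e) '' (Ideal.span (Set.range s) : Set (X.presheaf.stalk x)))) → y ∈ Ideal.span (Set.range s)} :=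
    lt_of_le_of_lt (Set.ncard_le_ncard_of_injOn π.base hmaps hinj hfin_diff)
      (Set.ncard_sdiff_singleton_lt_of_mem (by rw [Set.mem_setOf_eq]; exact hb) hfin)
  -- the class invariant on `X'`: transport along `π` off the centre
  have hP' : ∀ x' : X', ¬ (∀ d : ℕ, ringKrullDim (X'.presheaf.stalk x') = d → ∀ s : Fin d → X'.presheaf.stalk x', (Ideal.span (Set.range s)).radical.IsMaximal → ∀ y : X'.presheaf.stalk x', (∃ e : ℕ, y ^ p ^ e ∈ Ideal.span ((fun z : X'.presheaf.stalk x' => z ^ p ^ e) '' (Ideal.span (Set.range s) : Set (X'.presheaf.stalk x')))) → y ∈ Ideal.span (Set.range s)) → P X' (π ≫ f) x' := by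
    intro x' hx'
    have hx'B : x' ∈ {x' : X' | ¬ ∀ d : ℕ, ringKrullDim (X'.presheaf.stalk x') = d → ∀ s : Fin d → X'.presheaf.stalk x', (Ideal.span (Set.range s)).radical.IsMaximal → ∀ y : X'.presheaf.stalk x', (∃ e : ℕ, y ^ p ^ e ∈ Ideal.span ((fun z : X'.presheaf.stalk x' => z ^ p ^ e) '' (Ideal.span (Set.range s) : Set (X'.presheaf.stalk x')))) → y ∈ Ideal.span (Set.range s)} := by rw [Set.mem_setOf_eq]; exact hx'
    have h1 := hmaps x' hx'B
    exact htr X f hsep hft hqc hint hCM hfin J hJ0 X' π hπ x' (hoff x' hx'B)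
      (hP (π.base x') (by have := h1.1; rwa [Set.mem_setOf_eq] at this))
  exact ⟨X', π, hprop, hπ.isBirational' hJ0, inferInstance, inferInstance, inferInstance, inferInstance, hCM', hfin', hP', hlt⟩

/-- **G-β-rel — SEQUENTIAL SURGERY GLUE RELATIVE TO A CLASS `P` OF BAD POINTS** (plan-1 R10.2, CRUX-PLAN v10 §2, programme T-P):
see the module docstring. With `P := fun _ _ _ => True` and a trivial transport this is `SequentialSurgeryGlue.sequentialSurgeryGlue`.
[folklore] -/
theorem sequentialSurgeryGlueOfClass : ∀ (p : ℕ), p.Prime → ∀ (k : Type) [Field k] [CharP k p]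
    (P : ∀ (X : Scheme.{0}), (X ⟶ Spec (.of k)) → X → Prop),
    -- (iii) transport of `P` along blowing ups, at points off the centre
    (∀ (X₁ : Scheme.{0}) (f₁ : X₁ ⟶ Spec (.of k)),
      IsSeparated f₁ → LocallyOfFiniteType f₁ → QuasiCompact f₁ → IsIntegral X₁ →
      (∀ x : X₁, ∀ d : ℕ, ringKrullDim (X₁.presheaf.stalk x) = d → ∀ s : Fin d → X₁.presheaf.stalk x, (Ideal.span (Set.range s)).radical.IsMaximal → RingTheory.Sequence.IsWeaklyRegular (X₁.presheaf.stalk x) (List.ofFn s)) →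
      Set.Finite {x : X₁ | ¬ ∀ d : ℕ, ringKrullDim (X₁.presheaf.stalk x) = d → ∀ s : Fin d → X₁.presheaf.stalk x, (Ideal.span (Set.range s)).radical.IsMaximal → ∀ y : X₁.presheaf.stalk x, (∃ e : ℕ, y ^ p ^ e ∈ Ideal.span ((fun z : X₁.presheaf.stalk x => z ^ p ^ e) '' (Ideal.span (Set.range s) : Set (X₁.presheaf.stalk x)))) → y ∈ Ideal.span (Set.range s)} →
      ∀ (J : X₁.IdealSheafData), J ≠ ⊥ → ∀ (X' : Scheme.{0}) (π : X' ⟶ X₁), Literature.AlgebraicGeometry.Resolution.IsBlowup π J →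
        ∀ x' : X', π.base x' ∉ (J.support : Set X₁) → P X₁ f₁ (π.base x') → P X' (π ≫ f₁) x') →
    -- (ii) closed centres exist at the bad closed points of the class
    (∀ (X₁ : Scheme.{0}) (f₁ : X₁ ⟶ Spec (.of k)),
      IsSeparated f₁ → LocallyOfFiniteType f₁ → QuasiCompact f₁ → IsIntegral X₁ →
      (∀ x : X₁, ∀ d : ℕ, ringKrullDim (X₁.presheaf.stalk x) = d → ∀ s : Fin d → X₁.presheaf.stalk x, (Ideal.span (Set.range s)).radical.IsMaximal → RingTheory.Sequence.IsWeaklyRegular (X₁.presheaf.stalk x) (List.ofFn s)) →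
      Set.Finite {x : X₁ | ¬ ∀ d : ℕ, ringKrullDim (X₁.presheaf.stalk x) = d → ∀ s : Fin d → X₁.presheaf.stalk x, (Ideal.span (Set.range s)).radical.IsMaximal → ∀ y : X₁.presheaf.stalk x, (∃ e : ℕ, y ^ p ^ e ∈ Ideal.span ((fun z : X₁.presheaf.stalk x => z ^ p ^ e) '' (Ideal.span (Set.range s) : Set (X₁.presheaf.stalk x)))) → y ∈ Ideal.span (Set.range s)} →
      ∀ b : X₁, IsClosed ({b} : Set X₁) → (¬ ∀ d : ℕ, ringKrullDim (X₁.presheaf.stalk b) = d → ∀ s : Fin d → X₁.presheaf.stalk b, (Ideal.span (Set.range s)).radical.IsMaximal → ∀ y : X₁.presheaf.stalk b, (∃ e : ℕ, y ^ p ^ e ∈ Ideal.span ((fun z : X₁.presheaf.stalk b => z ^ p ^ e) '' (Ideal.span (Set.range s) : Set (X₁.presheaf.stalk b)))) → y ∈ Ideal.span (Set.range s)) →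
      P X₁ f₁ b →
      ∃ J : X₁.IdealSheafData, J ≠ ⊥ ∧ b ∈ (J.support : Set X₁) ∧
        ∀ (X' : Scheme.{0}) (π : X' ⟶ X₁), Literature.AlgebraicGeometry.Resolution.IsBlowup π J →
          ∀ x' : X', π.base x' ∈ (J.support : Set X₁) → IsDomain (X'.presheaf.stalk x') ∧ ∀ d : ℕ, ringKrullDim (X'.presheaf.stalk x') = d → ∀ s : Fin d → X'.presheaf.stalk x', (Ideal.span (Set.range s)).radical.IsMaximal → RingTheory.Sequence.IsWeaklyRegular (X'.presheaf.stalk x') (List.ofFn s) ∧ ∀ y : X'.presheaf.stalk x', (∃ e : ℕ, y ^ p ^ e ∈ Ideal.span ((fun z : X'.presheaf.stalk x' => z ^ p ^ e) '' (Ideal.span (Set.range s) : Set (X'.presheaf.stalk x')))) → y ∈ Ideal.span (Set.range s)) →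
    -- conclusion, for admissible pairs all of whose bad points lie in the class
    ∀ (X₁ : Scheme.{0}) (f₁ : X₁ ⟶ Spec (.of k)),
    IsSeparated f₁ → LocallyOfFiniteType f₁ → QuasiCompact f₁ → IsIntegral X₁ →
    (∀ x : X₁, ∀ d : ℕ, ringKrullDim (X₁.presheaf.stalk x) = d → ∀ s : Fin d → X₁.presheaf.stalk x, (Ideal.span (Set.range s)).radical.IsMaximal → RingTheory.Sequence.IsWeaklyRegular (X₁.presheaf.stalk x) (List.ofFn s)) →
    Set.Finite {x : X₁ | ¬ ∀ d : ℕ, ringKrullDim (X₁.presheaf.stalk x) = d → ∀ s : Fin d → X₁.presheaf.stalk x, (Ideal.span (Set.range s)).radical.IsMaximal → ∀ y : X₁.presheaf.stalk x, (∃ e : ℕ, y ^ p ^ e ∈ Ideal.span ((fun z : X₁.presheaf.stalk x => z ^ p ^ e) '' (Ideal.span (Set.range s) : Set (X₁.presheaf.stalk x)))) → y ∈ Ideal.span (Set.range s)} →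
    (∀ b : X₁, (¬ ∀ d : ℕ, ringKrullDim (X₁.presheaf.stalk b) = d → ∀ s : Fin d → X₁.presheaf.stalk b, (Ideal.span (Set.range s)).radical.IsMaximal → ∀ y : X₁.presheaf.stalk b, (∃ e : ℕ, y ^ p ^ e ∈ Ideal.span ((fun z : X₁.presheaf.stalk b => z ^ p ^ e) '' (Ideal.span (Set.range s) : Set (X₁.presheaf.stalk b)))) → y ∈ Ideal.span (Set.range s)) → P X₁ f₁ b) →
    ∃ (X' : Scheme.{0}) (π : X' ⟶ X₁), IsProper π ∧ Literature.AlgebraicGeometry.Resolution.IsBirational π ∧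
      ∀ x : X', IsDomain (X'.presheaf.stalk x) ∧ ∀ d : ℕ, ringKrullDim (X'.presheaf.stalk x) = d → ∀ s : Fin d → X'.presheaf.stalk x, (Ideal.span (Set.range s)).radical.IsMaximal → RingTheory.Sequence.IsWeaklyRegular (X'.presheaf.stalk x) (List.ofFn s) ∧ ∀ y : X'.presheaf.stalk x, (∃ e : ℕ, y ^ p ^ e ∈ Ideal.span ((fun z : X'.presheaf.stalk x => z ^ p ^ e) '' (Ideal.span (Set.range s) : Set (X'.presheaf.stalk x)))) → y ∈ Ideal.span (Set.range s)  := by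
  intro p hp k _ _ P htr h4 X₁ f₁ hsep hft hqc hint hCM hfin hP
  classical
  obtain ⟨σ', π, hπ, hbir, hPσ⟩ :=
    MeasureDescent.exists_model_of_wellFounded_step
      (S := {σ : Σ X : Scheme.{0}, (X ⟶ Spec (.of k)) //
        IsSeparated σ.2 ∧ LocallyOfFiniteType σ.2 ∧ QuasiCompact σ.2 ∧ IsIntegral σ.1 ∧
        (∀ x : σ.1, ∀ d : ℕ, ringKrullDim (σ.1.presheaf.stalk x) = d → ∀ s : Fin d → σ.1.presheaf.stalk x, (Ideal.span (Set.range s)).radical.IsMaximal → RingTheory.Sequence.IsWeaklyRegular (σ.1.presheaf.stalk x) (List.ofFn s)) ∧ Set.Finite {x : σ.1 | ¬ ∀ d : ℕ, ringKrullDim (σ.1.presheaf.stalk x) = d → ∀ s : Fin d → σ.1.presheaf.stalk x, (Ideal.span (Set.range s)).radical.IsMaximal → ∀ y : σ.1.presheaf.stalk x, (∃ e : ℕ, y ^ p ^ e ∈ Ideal.span ((fun z : σ.1.presheaf.stalk x => z ^ p ^ e) '' (Ideal.span (Set.range s) : Set (σ.1.presheaf.stalk x)))) → y ∈ Ideal.span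 (Set.range s)} ∧ (∀ x : σ.1, ¬ (∀ d : ℕ, ringKrullDim (σ.1.presheaf.stalk x) = d → ∀ s : Fin d → σ.1.presheaf.stalk x, (Ideal.span (Set.range s)).radical.IsMaximal → ∀ y : σ.1.presheaf.stalk x, (∃ e : ℕ, y ^ p ^ e ∈ Ideal.span ((fun z : σ.1.presheaf.stalk x => z ^ p ^ e) '' (Ideal.span (Set.range s) : Set (σ.1.presheaf.stalk x)))) → y ∈ Ideal.span (Set.range s)) → P σ.1 σ.2 x)})
      wellFounded_lt
      (fun σ => Set.ncard {x : σ.1.1 | ¬ ∀ d : ℕ, ringKrullDim (σ.1.1.presheaf.stalk x) = d → ∀ s : Fin d → σ.1.1.presheaf.stalk x, (Ideal.span (Set.range s)).radical.IsMaximal → ∀ y : σ.1.1.presheaf.stalk x, (∃ e : ℕ, y ^ p ^ e ∈ Ideal.span ((fun z : σ.1.1.presheaf.stalk x => z ^ p ^ e) '' (Ideal.span (Set.range s) : Set (σ.1.1.presheaf.stalk x)))) → y ∈ Ideal.span (Set.range s)})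
      (fun σ => σ.1.1)
      (fun σ => ∀ x : σ.1.1, ∀ d : ℕ, ringKrullDim (σ.1.1.presheaf.stalk x) = d → ∀ s : Fin d → σ.1.1.presheaf.stalk x, (Ideal.span (Set.range s)).radical.IsMaximal → ∀ y : σ.1.1.presheaf.stalk x, (∃ e : ℕ, y ^ p ^ e ∈ Ideal.span ((fun z : σ.1.1.presheaf.stalk x => z ^ p ^ e) '' (Ideal.span (Set.range s) : Set (σ.1.1.presheaf.stalk x)))) → y ∈ Ideal.span (Set.range s))
      (fun σ hσ => by
        obtain ⟨X', π, hπ, hbir, hs', hl', hq', hi', hc', hf', hP', hlt⟩ :=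
          surgeryStepOfClass p hp k P htr h4 σ.1.1 σ.1.2 σ.2.1 σ.2.2.1 σ.2.2.2.1 σ.2.2.2.2.1 σ.2.2.2.2.2.1
            σ.2.2.2.2.2.2.1 σ.2.2.2.2.2.2.2 (not_forall.mp hσ)
        exact ⟨⟨⟨X', π ≫ σ.1.2⟩, hs', hl', hq', hi', hc', hf', hP'⟩, π, hπ, hbir, hlt⟩)
      ⟨⟨X₁, f₁⟩, hsep, hft, hqc, hint, hCM, hfin, hP⟩
  haveI : IsIntegral σ'.1.1 := σ'.2.2.2.2.1
  exact ⟨σ'.1.1, π, hπ, hbir, fun x => ⟨inferInstance, fun d hd s hs => ⟨σ'.2.2.2.2.2.1 x d hd s hs, hPσ x d hd s hs⟩⟩⟩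

/-- **Sanity / plug test**: G-β (`SequentialSurgeryGlue.sequentialSurgeryGlue`, p503539) is the class `P := True` of G-β-rel —
the term of `L/w45a/ClassGlueSig.lean` v1 `sequentialSurgeryGlue_of_class` with the stub replaced by the theorem. [folklore] -/
theorem sequentialSurgeryGlue_of_class (p : ℕ) (hp : p.Prime) (k : Type) [Field k] [CharP k p]
    (h4 : ∀ (X₁ : Scheme.{0}) (f₁ : X₁ ⟶ Spec (.of k)),
      IsSeparated f₁ → LocallyOfFiniteType f₁ → QuasiCompact f₁ → IsIntegral X₁ →
      (∀ x : X₁, ∀ d : ℕ, ringKrullDim (X₁.presheaf.stalk x) = d → ∀ s : Fin d → X₁.presheaf.stalk x, (Ideal.span (Set.range s)).radical.IsMaximal → RingTheory.Sequence.IsWeaklyRegular (X₁.presheaf.stalk x) (List.ofFn s)) →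
      Set.Finite {x : X₁ | ¬ ∀ d : ℕ, ringKrullDim (X₁.presheaf.stalk x) = d → ∀ s : Fin d → X₁.presheaf.stalk x, (Ideal.span (Set.range s)).radical.IsMaximal → ∀ y : X₁.presheaf.stalk x, (∃ e : ℕ, y ^ p ^ e ∈ Ideal.span ((fun z : X₁.presheaf.stalk x => z ^ p ^ e) '' (Ideal.span (Set.range s) : Set (X₁.presheaf.stalk x)))) → y ∈ Ideal.span (Set.range s)} →
      ∀ b : X₁, IsClosed ({b} : Set X₁) → (¬ ∀ d : ℕ, ringKrullDim (X₁.presheaf.stalk b) = d → ∀ s : Fin d → X₁.presheaf.stalk b, (Ideal.span (Set.range s)).radical.IsMaximal → ∀ y : X₁.presheaf.stalk b, (∃ e : ℕ, y ^ p ^ e ∈ Ideal.span ((fun z : X₁.presheaf.stalk b => z ^ p ^ e) '' (Ideal.span (Set.range s) : Set (X₁.presheaf.stalk b)))) → y ∈ Ideal.span (Set.range s)) →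
      ∃ J : X₁.IdealSheafData, J ≠ ⊥ ∧ b ∈ (J.support : Set X₁) ∧
        ∀ (X' : Scheme.{0}) (π : X' ⟶ X₁), Literature.AlgebraicGeometry.Resolution.IsBlowup π J →
          ∀ x' : X', π.base x' ∈ (J.support : Set X₁) → IsDomain (X'.presheaf.stalk x') ∧ ∀ d : ℕ, ringKrullDim (X'.presheaf.stalk x') = d → ∀ s : Fin d → X'.presheaf.stalk x', (Ideal.span (Set.range s)).radical.IsMaximal → RingTheory.Sequence.IsWeaklyRegular (X'.presheaf.stalk x') (List.ofFn s) ∧ ∀ y : X'.presheaf.stalk x', (∃ e : ℕ, y ^ p ^ e ∈ Ideal.span ((fun z : X'.presheaf.stalk x' => z ^ p ^ e) '' (Ideal.span (Set.range s) : Set (X'.presheaf.stalk x')))) → y ∈ Ideal.span (Set.range s))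
    (X₁ : Scheme.{0}) (f₁ : X₁ ⟶ Spec (.of k)) (hsep : IsSeparated f₁) (hft : LocallyOfFiniteType f₁) (hqc : QuasiCompact f₁)
    (hint : IsIntegral X₁)
    (hCM : ∀ x : X₁, ∀ d : ℕ, ringKrullDim (X₁.presheaf.stalk x) = d → ∀ s : Fin d → X₁.presheaf.stalk x, (Ideal.span (Set.range s)).radical.IsMaximal → RingTheory.Sequence.IsWeaklyRegular (X₁.presheaf.stalk x) (List.ofFn s))
    (hfin : Set.Finite {x : X₁ | ¬ ∀ d : ℕ, ringKrullDim (X₁.presheaf.stalk x) = d → ∀ s : Fin d → X₁.presheaf.stalk x, (Ideal.span (Set.range s)).radical.IsMaximal → ∀ y : X₁.presheaf.stalk x, (∃ e : ℕ, y ^ p ^ e ∈ Ideal.span ((fun z : X₁.presheaf.stalk x => z ^ p ^ e) '' (Ideal.span (Set.range s) : Set (X₁.presheaf.stalk x)))) → y ∈ Ideal.span (Set.range s)}) :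
    ∃ (X' : Scheme.{0}) (π : X' ⟶ X₁), IsProper π ∧ Literature.AlgebraicGeometry.Resolution.IsBirational π ∧
      ∀ x : X', IsDomain (X'.presheaf.stalk x) ∧ ∀ d : ℕ, ringKrullDim (X'.presheaf.stalk x) = d → ∀ s : Fin d → X'.presheaf.stalk x, (Ideal.span (Set.range s)).radical.IsMaximal → RingTheory.Sequence.IsWeaklyRegular (X'.presheaf.stalk x) (List.ofFn s) ∧ ∀ y : X'.presheaf.stalk x, (∃ e : ℕ, y ^ p ^ e ∈ Ideal.span ((fun z : X'.presheaf.stalk x => z ^ p ^ e) '' (Ideal.span (Set.range s) : Set (X'.presheaf.stalk x)))) → y ∈ Ideal.span (Set.range s) :=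
  sequentialSurgeryGlueOfClass p hp k (fun _ _ _ => True)
    (fun _ _ _ _ _ _ _ _ _ _ _ _ _ _ _ _ => trivial)
    (fun X₁ f₁ hs hl hq hi hc hf b hbcl hb _ => h4 X₁ f₁ hs hl hq hi hc hf b hbcl hb)
    X₁ f₁ hsep hft hqc hint hCM hfin (fun _ _ => trivial)

end Summit.ResolutionOfSingularities.ResolutionOfSingularities.Theorems.FInjectiveMacaulayfication.SequentialSurgeryGlueOfClass

end
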